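import Mathlib
import Summits.Ventures.HodgeRepro2.Tier7.Line1.SepModule

/-!
# Tier7/Line1/SepAct — the Hecke generators of the separating datum and the group `G`

The SEPARATING DATUM of t7-L1-p2 (LINE L1, residual probe), the Hecke action. A form-preserving automorphism `ρ` of
`U` gives a `ℂ`-algebra automorphism of the first curve `A₁` (`UAut.algEquiv₁`, through `Curve.AutData`); an
augmentation-preserving automorphism `σ₁` of `A₁` together with a signed permutation `(π, ε)` of the two
holomorphic classes `e₀, e₁` of the second curve gives an automorphism of `HXS J` (`HAutData.algEquiv`). The four
kinds of generators: the flips and signs of `SepWeight` on `U` (`σ₁` from `flipU n`, `sgnU n`), the swap `e₀ ↔ e₁`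
and the sign `e₁ ↦ -e₁`. `G := FreeGroup (Bool × Option ℕ)` acts through `FreeGroup.lift`; every generator is an
involution, so a property of the generators closed under composition holds for the whole group (`lift_gen_prop`).
Author: t7-L1-p2 (prover-pub-hodge-repro2-t7-L1-p2-g0-0). §8(d): NO.
-/

namespace Summit.Ventures.HodgeRepro2.Tier7.Line1.Sep

open Finset

noncomputable section

/-! ## Automorphisms of the first curve from automorphisms of `U` -/

/-- a `ℂ`-linear automorphism of `U` preserving the form -/
structure UAut where
  /-- the automorphism -/
  ρ : U ≃ₗ[ℂ] U
  /-- it preserves `Bform` -/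
  form : ∀ u w, Bform (ρ u) (ρ w) = Bform u w

namespace UAut

/-- the compatible triple on the first curve: trivial on `ℂ`, `ρ × ρ` on `U × U`, trivial on the junk -/
def autData₁ (a : UAut) : Curve.AutData (R := ℂ) (V := V₁) (J := Unit) β₁ where
  σ := AlgEquiv.refl
  τ := LinearEquiv.prodCongr a.ρ a.ρ
  κ := LinearEquiv.refl ℂ Unit
  τ_smul r v := by simp
  κ_smul r j := by simp
  β_map v w := by simp [β₁_apply, a.form]

/-- the induced automorphism of `A₁` -/
def algEquiv₁ (a : UAut) : A₁ ≃ₐ[ℂ] A₁ := a.autData₁.toAlgEquiv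

/-- `algEquiv₁` on the components -/
theorem algEquiv₁_apply (a : UAut) (x : A₁) :
    a.algEquiv₁ x = ⟨x.c, (a.ρ x.v.1, a.ρ x.v.2), x.t, ()⟩ := by
  ext <;> simp [algEquiv₁, autData₁]

/-- `algEquiv₁` preserves the augmentation -/
theorem algEquiv₁_c (a : UAut) (x : A₁) : (a.algEquiv₁ x).c = x.c := by
  rw [algEquiv₁_apply]

/-- `algEquiv₁` on a holomorphic class -/
theorem algEquiv₁_holA (a : UAut) (u : U) : a.algEquiv₁ (holA u) = holA (a.ρ u) := by
  rw [algEquiv₁_apply]; simp [holA]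

/-- `algEquiv₁` on an antiholomorphic class -/
theorem algEquiv₁_antiA (a : UAut) (u : U) : a.algEquiv₁ (antiA u) = antiA (a.ρ u) := by
  rw [algEquiv₁_apply]; simp [antiA]

/-- the flip at `n` -/
def flip (n : ℕ) : UAut := ⟨flipU n, Bform_flipU n⟩

/-- the sign at `n` -/
def sgn (n : ℕ) : UAut := ⟨sgnU n, Bform_sgnU n⟩

end UAut

/-! ## Automorphisms of `HXS J` -/

variable {J : Type} [AddCommGroup J] [Module ℂ J]

/-- the data of a Hecke generator on `HXS J`: an augmentation-preserving automorphism `σ₁` of `A₁`, a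
permutation `π` of the two holomorphic classes of the second curve and signs `ε` with `ε k ^ 2 = 1` -/
structure HAutData where
  /-- the automorphism of the first curve -/
  σ₁ : A₁ ≃ₐ[ℂ] A₁
  /-- it preserves the augmentation -/
  σ₁_c : ∀ x, (σ₁ x).c = x.c
  /-- the permutation of the classes `e₀, e₁` -/
  π : Equiv.Perm (Fin 2)
  /-- the signs -/
  ε : Fin 2 → ℂ
  /-- the signs square to one -/
  ε_sq : ∀ k, ε k * ε k = 1

namespace HAutData

variable (D : HAutData)

/-- the action on `Fin 2 → A₁`: `(a k) ↦ (ε k • σ₁ (a (π k)))` -/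
def actFun (a : Fin 2 → A₁) : Fin 2 → A₁ := fun k => D.ε k • D.σ₁ (a (D.π k))

/-- `actFun` unfolded -/
@[simp] theorem actFun_apply (a : Fin 2 → A₁) (k : Fin 2) : D.actFun a k = D.ε k • D.σ₁ (a (D.π k)) := rfl

/-- the inverse action: `(a k) ↦ ε (π⁻¹ k) • σ₁⁻¹ (a (π⁻¹ k))` -/
def actFunInv (a : Fin 2 → A₁) : Fin 2 → A₁ := fun k => D.ε (D.π.symm k) • D.σ₁.symm (a (D.π.symm k))

/-- `actFunInv ∘ actFun = id` -/
theorem actFunInv_actFun (a : Fin 2 → A₁) : D.actFunInv (D.actFun a) = a := by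
  funext k
  simp only [actFunInv, actFun_apply, Equiv.apply_symm_apply, map_smul, AlgEquiv.symm_apply_apply,
    smul_smul, D.ε_sq, one_smul]

/-- `actFun ∘ actFunInv = id` -/
theorem actFun_actFunInv (a : Fin 2 → A₁) : D.actFun (D.actFunInv a) = a := by
  funext k
  simp only [actFun_apply, actFunInv, Equiv.symm_apply_apply, map_smul, AlgEquiv.apply_symm_apply,
    smul_smul, D.ε_sq, one_smul]

/-- the `ℂ`-linear automorphism of `V₂` -/
def τ₂ : V₂ ≃ₗ[ℂ] V₂ where
  toFun v := (D.actFun v.1, D.actFun v.2)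
  invFun v := (D.actFunInv v.1, D.actFunInv v.2)
  left_inv v := by simp [actFunInv_actFun]
  right_inv v := by simp [actFun_actFunInv]
  map_add' v w := by
    ext k <;> simp [actFun, smul_add]
  map_smul' c v := by
    ext k <;> simp [actFun, smul_comm c]

/-- `τ₂` unfolded -/
@[simp] theorem τ₂_apply (v : V₂) : D.τ₂ v = (D.actFun v.1, D.actFun v.2) := rfl

/-- `β₂` is preserved -/
theorem β₂_τ₂ (v w : V₂) : β₂ (D.τ₂ v) (D.τ₂ w) = D.σ₁ (β₂ v w) := by
  simp only [β₂_apply, τ₂_apply, actFun_apply, map_sum, map_add, map_mul, Algebra.smul_mul_assoc,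
    Algebra.mul_smul_comm, smul_smul, D.ε_sq, one_smul]
  exact Equiv.sum_comp D.π fun k => D.σ₁ (v.1 k) * D.σ₁ (w.2 k) + D.σ₁ (w.1 k) * D.σ₁ (v.2 k)

/-- the compatible triple on `HXS J` -/
def autData : Curve.AutData (R := A₁) (V := V₂) (J := Junk J) β₂ where
  σ := D.σ₁
  τ := D.τ₂
  κ := LinearEquiv.refl ℂ (Junk J)
  τ_smul r v := by
    ext k <;> simp [actFun, Algebra.mul_smul_comm]
  κ_smul r j := by
    simp only [LinearEquiv.refl_apply, Junk.smul_def, D.σ₁_c]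
  β_map := D.β₂_τ₂

/-- the Hecke generator as a `ℂ`-algebra automorphism of `HXS J` -/
def algEquiv : HXS J ≃ₐ[ℂ] HXS J := (D.autData (J := J)).toAlgEquiv

/-- `algEquiv` on the components -/
theorem algEquiv_apply (x : HXS J) :
    D.algEquiv x = ⟨D.σ₁ x.c, (D.actFun x.v.1, D.actFun x.v.2), D.σ₁ x.t, x.j⟩ := by
  ext <;> simp [algEquiv, autData]

end HAutData

/-! ## The four kinds of generators and the group -/

/-- the generator from an automorphism of `U`: `σ₁ = algEquiv₁`, trivial on the second curve -/
def HAutData.ofUAut (a : UAut) : HAutData where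
  σ₁ := a.algEquiv₁
  σ₁_c := a.algEquiv₁_c
  π := 1
  ε := 1
  ε_sq _ := by simp

/-- the swap `e₀ ↔ e₁` -/
def HAutData.swap : HAutData where
  σ₁ := AlgEquiv.refl
  σ₁_c _ := rfl
  π := Equiv.swap 0 1
  ε := 1
  ε_sq _ := by simp

/-- the sign `e₁ ↦ -e₁` -/
def HAutData.sign : HAutData where
  σ₁ := AlgEquiv.refl
  σ₁_c _ := rfl
  π := 1
  ε := signK
  ε_sq := signK_mul_self

/-- the generator data indexed by `Bool × Option ℕ`: `(false, some n)` = flip, `(true, some n)` = sign,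
`(false, none)` = swap, `(true, none)` = index sign -/
def genData : Bool × Option ℕ → HAutData
  | (false, some n) => HAutData.ofUAut (UAut.flip n)
  | (true, some n) => HAutData.ofUAut (UAut.sgn n)
  | (false, none) => HAutData.swap
  | (true, none) => HAutData.sign

/-- the generators as automorphisms of `HXS J` -/
def gen (J : Type) [AddCommGroup J] [Module ℂ J] (s : Bool × Option ℕ) : HXS J ≃ₐ[ℂ] HXS J :=
  (genData s).algEquiv

/-- the Hecke group of the separating datum -/
abbrev G := FreeGroup (Bool × Option ℕ)

/-- the action of `G` on `HXS J` -/
instance : MulAction G (HXS J) := MulAction.compHom (HXS J) (FreeGroup.lift (gen J))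

/-- the action unfolded -/
theorem smul_def (g : G) (x : HXS J) : g • x = FreeGroup.lift (gen J) g x := rfl

/-- a generator acts by itself -/
theorem of_smul (s : Bool × Option ℕ) (x : HXS J) : FreeGroup.of s • x = gen J s x := by
  simp [smul_def]

/-! ## The generators are involutions -/

/-- an involutive `HAutData` gives an involutive automorphism -/
theorem HAutData.algEquiv_algEquiv (D : HAutData) (hσ : ∀ y, D.σ₁ (D.σ₁ y) = y)
    (hπ : ∀ k, D.π (D.π k) = k) (hε : ∀ k, D.ε k * D.ε (D.π k) = 1) (x : HXS J) :
    D.algEquiv (D.algEquiv x) = x := by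
  rw [HAutData.algEquiv_apply, HAutData.algEquiv_apply]
  ext <;> simp [hσ, hπ, hε, HAutData.actFun, smul_smul]

/-- `flipU` is an involution -/
theorem flipU_flipU (n : ℕ) (u : U) : flipU n (flipU n u) = u := Subtype.ext (flip_flip n u)

/-- `sgnU` is an involution -/
theorem sgnU_sgnU (n : ℕ) (u : U) : sgnU n (sgnU n u) = u := Subtype.ext (sgn_sgn n u)

/-- `algEquiv₁` of an involution is an involution -/
theorem UAut.algEquiv₁_algEquiv₁ (a : UAut) (ha : ∀ u, a.ρ (a.ρ u) = u) (y : A₁) :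
    a.algEquiv₁ (a.algEquiv₁ y) = y := by
  rw [UAut.algEquiv₁_apply, UAut.algEquiv₁_apply]
  ext <;> simp [ha]

/-- every generator is an involution -/
theorem gen_gen (s : Bool × Option ℕ) (x : HXS J) : gen J s (gen J s x) = x := by
  rcases s with ⟨b, n⟩
  rcases b with _ | _ <;> rcases n with _ | n
  · exact HAutData.algEquiv_algEquiv _ (fun _ => rfl) (fun k => Equiv.swap_apply_self 0 1 k)
      (fun _ => by simp [genData, HAutData.swap]) x
  · exact HAutData.algEquiv_algEquiv _ ((UAut.flip n).algEquiv₁_algEquiv₁ (flipU_flipU n))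
      (fun _ => rfl) (fun _ => by simp [genData, HAutData.ofUAut]) x
  · exact HAutData.algEquiv_algEquiv _ (fun _ => rfl) (fun _ => rfl)
      (fun k => by simpa [genData, HAutData.sign] using signK_mul_self k) x
  · exact HAutData.algEquiv_algEquiv _ ((UAut.sgn n).algEquiv₁_algEquiv₁ (sgnU_sgnU n))
      (fun _ => rfl) (fun _ => by simp [genData, HAutData.ofUAut]) x

/-- the inverse of a generator is itself -/
theorem gen_inv (s : Bool × Option ℕ) : (gen J s)⁻¹ = gen J s := by
  rw [AlgEquiv.aut_inv]
  exact AlgEquiv.ext fun x => (AlgEquiv.symm_apply_eq _).2 (gen_gen s x).symm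

/-- a property of automorphisms holding for the generators and closed under composition holds for
the whole group -/
theorem lift_gen_prop (P : (HXS J ≃ₐ[ℂ] HXS J) → Prop) (h1 : P 1) (hgen : ∀ s, P (gen J s))
    (hmul : ∀ a b, P a → P b → P (a * b)) (g : G) : P (FreeGroup.lift (gen J) g) := by
  induction g using FreeGroup.induction_on with
  | C1 => simpa using h1
  | of s => simpa using hgen s
  | inv_of s _ => rw [map_inv]; simpa [gen_inv] using hgen s
  | mul a b ha hb => rw [map_mul]; exact hmul _ _ ha hb

/-! ## The model `M` and the transfer -/

/-- the generators on the model `M`, matching `genData` -/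
def genM : Bool × Option ℕ → (M ≃ₗ[ℂ] M)
  | (false, some n) => flipM n
  | (true, some n) => sgnM n
  | (false, none) => swapM
  | (true, none) => signM

/-- the action of `G` on the model `M` -/
instance : MulAction G M := MulAction.compHom M (FreeGroup.lift genM)

/-- the action on `M` unfolded -/
theorem smul_def_M (g : G) (x : M) : g • x = FreeGroup.lift genM g x := rfl

/-- a generator acts on `M` by itself -/
theorem of_smul_M (s : Bool × Option ℕ) (x : M) : FreeGroup.of s • x = genM s x := by
  simp [smul_def_M]

/-- the embedding `M → HXS J`, `x ↦ ∑ k, holA (x k) · e k` -/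
def ι : M →ₗ[ℂ] HXS J where
  toFun x := ⟨0, (fun k => holA (x k), 0), 0, 0⟩
  map_add' x y := by
    ext <;> simp [holA_add]
  map_smul' c x := by
    ext <;> simp [holA_smul]

/-- `ι` unfolded -/
theorem ι_apply (x : M) : (ι x : HXS J) = ⟨0, (fun k => holA (x k), 0), 0, 0⟩ := rfl

/-- `ι` is injective -/
theorem ι_injective : Function.Injective (ι (J := J)) := by
  intro x y h
  funext k
  have := congrArg (fun z : HXS J => z.v.1 k) h
  exact holA_injective this

/-- the generators act on the image of `M` through `genM` -/
theorem gen_ι (s : Bool × Option ℕ) (x : M) : gen J s (ι x) = ι (genM s x) := by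
  rcases s with ⟨b, n⟩
  rcases b with _ | _ <;> rcases n with _ | n
  · simp only [gen, genData, genM, HAutData.algEquiv_apply, HAutData.swap, ι_apply]
    ext <;> simp [HAutData.actFun]
  · simp only [gen, genData, genM, HAutData.algEquiv_apply, HAutData.ofUAut, ι_apply]
    ext <;> simp [HAutData.actFun, UAut.algEquiv₁_holA, UAut.flip]
  · simp only [gen, genData, genM, HAutData.algEquiv_apply, HAutData.sign, ι_apply]
    ext <;> simp [HAutData.actFun, holA_smul]
  · simp only [gen, genData, genM, HAutData.algEquiv_apply, HAutData.ofUAut, ι_apply]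
    ext <;> simp [HAutData.actFun, UAut.algEquiv₁_holA, UAut.sgn]

/-- THE TRANSFER: `G` acts on the image of `M` through its action on `M` -/
theorem smul_ι (g : G) (x : M) : g • (ι x : HXS J) = ι (g • x) := by
  induction g using FreeGroup.induction_on generalizing x with
  | C1 => rw [one_smul, one_smul]
  | of s => rw [of_smul, of_smul_M, gen_ι]
  | inv_of s ih =>
    have h := ih ((FreeGroup.of s)⁻¹ • x)
    rw [smul_inv_smul] at h
    rw [← h, inv_smul_smul]
  | mul a b ha hb => rw [mul_smul, mul_smul, hb, ha]

end

end Summit.Ventures.HodgeRepro2.Tier7.Line1.Sep
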